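import Summits.QuantumFields.YangMills.Theorems.FluctuationComparisonRegPrIntLS2BetaChartReadIterTranslate
import Summits.QuantumFields.YangMills.Theorems.FluctuationComparisonRegPrIntLS2BetaChartReadIterGaugeCovariance
import Summits.QuantumFields.YangMills.Theorems.FluctuationComparisonRegPrIntLS2BetaThinRectangleTransport
import Literature.MathematicalPhysics.QuantumFieldTheory.Balaban1983to89.T4UndoubledRP
import HarnessLib

/-!
# S2β · (REG-UP)′ bridge (O2-b3-α) — «hDcov FROM THE LETTERS»: the covariant-translation letter of px13 g29's ✓p840162 `…CovariantOscillationKUniform` assembled from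
# translation equivariance (O2-a ✓p840185), gauge covariance (O2-c ✓p840250) and the thin-rectangle transport (O2-d ✓p840269), MODULO two displayed letters:
# the line-vs-average letter `ε` and the background-Lipschitz letter `β₁` (to be inhabited by (O2-b3-β) from ✓p840374 (b1) + ✓p840392 (b2))

Cell `ym3-torus` (YM ladder rung R3 = continuum `SU(2)` Yang–Mills on the three-torus at fixed lattice data — a RUNG: NOT d = 4, NOT infinite volume, NOT a mass gap,
NOT Clay).  Width seat «width 12» `ym3-torus-px12` (gen 27); crux `stmt-QuantumFields-20520`, LINE g18-1 S2β, node (REG-UP)′ (architect px17 g23 02:45:41Z (b): «hDcov COVERED BY NAME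
modulo assembly»; px12 g27 03:07Z claim).  `--kind proof --supports stmt-QuantumFields-20520 --as helper`, count-neutral, DEFINITION-FREE (0 `def`, 0 `instance`, 0 `notation`, 0 `sorry`,
default heartbeats).  Generic `P : Params`, `SU(N)`, levels `0 → k` (`k ≤ m + K`); the segment `j → l` of the tower is the case `0 → l − j` on the shorter tower (✓p840392 §3).

THE OBJECTS (all spelled out in the statements).  `Ψ_k^{V} A c := Λ(Ū^k(Θ(A)·V)(c)·Ū^k(V)(c)⁻¹)` (k-step chart-read about the background `V`), `D^{V} := fderiv ℝ Ψ_k^{V} 0`;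
the coarse unit vector `e_μ = (0 : Site P k).shift μ` and its fine vector `T := scaleTo k e_μ = L^k·e_μ`; the STRAIGHT μ-TRANSPORT `h x := rowProd U₀ x μ L^k = U₀[x, x + L^k e_μ]`
(a level-0 gauge transformation); the RE-GAUGED TRANSLATE `U′ := h • τ_T U₀` (bondwise `U′(b)·U₀(b)⁻¹ = U₀(∂R_{L^k×1})`, ✓p840269); the COVARIANT TRANSLATE of the datum
`Y′ b := Ad_{h(b₋)} X(b + T)`; `h_k := transfUp h k` (`h` at the block representatives).

WHAT IS PROVED (sorry-free).
§0 torus algebra: `shift_eq_add_zero_shift`, `translate_zero_shift` (`c + e_μ = ⟨c₋.shift μ, c.dir⟩`), `add_scaleTo_zero_shift` (`x + L^k e_μ = shiftN x μ L^k`),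
   `translate_scaleTo_eq_shiftN` (`τ_T U₀ = (b ↦ U₀⟨shiftN b₋ μ L^k, b.dir⟩)`), ★`dist1_regaugedTranslate_mul_inv_le` (`dist1 (U′ b·U₀ b⁻¹) ≤ L^k·α` from the plaquette class — ✓p840269).
§1 ★★ THE EXACT IDENTITY `coe_fderiv_chartRead_iter_gaugeAct_translate` (any `h`, any coarse vector `v`): `↑(D^{h•τ_{L^k v}U₀}(Ad_h (X∘τ)) c) = ↑(h_k c₋)·↑(D^{U₀} X (c + v))·↑(h_k c₋)⋆`
   (✓p840250 ∘ ✓p840185); ★★`coe_fderiv_regaugedTranslate` — at `v = e_μ`, `c = ⟨ȳ, κ⟩`: `↑(D^{U′} Y′ ⟨ȳ,κ⟩) = ↑(h_k ȳ)·↑(D^{U₀} X ⟨ȳ.shift μ, κ⟩)·↑(h_k ȳ)⋆`.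
§2 `norm_conj_sub_conj_le` (`‖G·M·G⋆ − u·M·u⋆‖ ≤ 2‖G − u‖·‖M‖` on `SU(N)`); ★★★**`hDcov_of_letters (hD : ∀ c, ‖↑(D^{U₀} X c)‖ ≤ Λ) (hline : ∀ ȳ, ‖↑(Ū^k U₀ ⟨ȳ,μ⟩) − ↑(h_k ȳ)‖ ≤ ε)
   (hLip : ∀ c, ‖↑(D^{U′} Y′ c) − ↑(D^{U₀} Y′ c)‖ ≤ β₁) (ȳ κ) : ‖↑(Ū^k U₀ ⟨ȳ,μ⟩)·↑(D^{U₀} X ⟨ȳ.shift μ, κ⟩)·↑(Ū^k U₀ ⟨ȳ,μ⟩)⋆ − ↑(D^{U₀} Y′ ⟨ȳ,κ⟩)‖ ≤ 2·ε·Λ + β₁`** —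
   px13's `hDcov` second conjunct with `β := 2εΛ + β₁`; ★★`hDcov_of_letters_exists` — the `∃ Y′, (∀ b, ‖↑(Y′ b) − ↑(X b)‖ ≤ ℓ·c₀) ∧ ∀ κ, … ≤ 2εΛ + β₁` packaging, the first conjunct
   being the COVARIANT μ-WORD OSCILLATION of `X` over `L^k` steps (hypothesis `hc₀`, px13's `c₀` letter by ✓p839768 `wordOsc_of_step`).

HONEST SCOPE.  Chain-rule algebra and two triangle inequalities over the landed letters; the line-vs-average letter `ε` (Ū^k vs the straight fine word: correction factors
of [Balaban1987RG1] (0.4), area `L^k × L^k`) and the k-step background-Lipschitz letter `β₁` (telescope of ✓p840374 over ✓p840392's segment rows in block-pair axial gauges) are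
DISPLAYED HYPOTHESES here, inhabited in (O2-b3-β); nothing of Bałaban's renormalisation-group analysis proved ([Balaban1985Averaging] Prop. 4 (128)–(131) pp.37–38 is the printed locus of
hDcov); (hNL)∕(REG-UP)′∕GAP♯∘ (`stub_uniformFibreGapOrbit`, registry 3732b7df UNTOUCHED, 0∕5), the five registered stubs, S2β, crux 20520, 19936, 19200, `YM3TorusSU2` — NOT proved;
rung R3 — NOT d = 4, NOT infinite volume, NOT a mass gap, NOT Clay; the Yang–Mills mass gap is NOT proved.
-/

set_option autoImplicit false

noncomputable section

open scoped Matrix.Norms.L2Operator Topology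
open Filter Set Function

namespace Summit.QuantumFields.YangMills.Theorems.FluctuationComparisonRegPrIntLS2BetaChartReadDerivCovariantTranslation

open Literature.MathematicalPhysics.QuantumFieldTheory.Balaban1983to89
open Literature.MathematicalPhysics.QuantumFieldTheory.Balaban1983to89.HaarExponentialChart
open Literature.MathematicalPhysics.QuantumFieldTheory.Balaban1983to89.HaarExponentialChart.IsChartRep
open Literature.MathematicalPhysics.QuantumFieldTheory.Balaban1983to89.BlockAveraging (Small Idx avgFun loopHol blockAvg blockAvg_avg)
open Literature.MathematicalPhysics.QuantumFieldTheory.Balaban1983to89.ExpMeanLog (expMeanLogSU deltaSU)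
open Literature.MathematicalPhysics.QuantumFieldTheory.Balaban1983to89.Node00
open Literature.MathematicalPhysics.QuantumFieldTheory.Balaban1983to89.T4Continuum (transfUp iter_gaugeAct)
open Literature.MathematicalPhysics.QuantumFieldTheory.Balaban1983to89.T4UndoubledRP (zero_shift_eq scaleTo_update)
open Literature.MathematicalPhysics.QuantumFieldTheory.Balaban1983to89.B10Eq47AxialChi (shiftN shiftN_zero shiftN_succ rowProd rowProd_zero rowProd_succ rect)
open Summit.QuantumFields.YangMills.BalabanUVNodes.N09ChartReadAveragingSmooth
open Summit.QuantumFields.YangMills.BalabanUVNodes.N09CentralWindowInjective (norm_coe_SU_le_one)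
open Summit.QuantumFields.YangMills.Theorems.AvgActionDefect (shiftN_apply)
open Summit.QuantumFields.YangMills.Theorems.FluctuationComparisonRegPrIntLS2BetaChartReadGaugeCovariance (conj_mem_lie)
open Summit.QuantumFields.YangMills.Theorems.FluctuationComparisonRegPrIntLS2BetaChartReadIterTranslate (smallBelow_translate fderiv_chartRead_iter_translate)
open Summit.QuantumFields.YangMills.Theorems.FluctuationComparisonRegPrIntLS2BetaChartReadIterGaugeCovariance (smallBelow_gaugeAct coe_fderiv_chartRead_iter_gaugeAct)
open Summit.QuantumFields.YangMills.Theorems.FluctuationComparisonRegPrIntLS2BetaThinRectangleTransport (translate_eq_shiftN dist1_gaugeAct_rowProd_shift_mul_inv_le)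

variable {P : Params} {N : ℕ} [NeZero N]

/-! ## §0 Torus algebra: the coarse unit vector, its fine vector, the straight transport -/

/-- `x.shift μ = x + e_μ` with `e_μ = (0 : Site).shift μ`. [folklore] -/
theorem shift_eq_add_zero_shift {j : ℕ} (x : Site P j) (μ : Fin P.d) : x.shift μ = x + (0 : Site P j).shift μ := by
  have h := Site.shift_add (0 : Site P j) x μ
  rw [zero_add] at h
  rw [h, add_comm]

/-- `c + e_μ = ⟨c₋.shift μ, c.dir⟩`. [folklore] -/
theorem translate_zero_shift {j : ℕ} (c : PBond P j) (μ : Fin P.d) : c.translate ((0 : Site P j).shift μ) = ⟨c.src.shift μ, c.dir⟩ := by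
  obtain ⟨x, κ⟩ := c
  show (⟨x + (0 : Site P j).shift μ, κ⟩ : PBond P j) = ⟨x.shift μ, κ⟩
  rw [← shift_eq_add_zero_shift]

/-- `x + L^k·e_μ = shiftN x μ L^k` (the fine vector of the coarse unit vector is `L^k` fine μ-steps). [cite: Balaban1987RG1, (0.1) p.252] -/
theorem add_scaleTo_zero_shift (k : ℕ) (μ : Fin P.d) (x : Site P 0) :
    x + Site.scaleTo k ((0 : Site P k).shift μ) = shiftN x μ (P.L ^ k) := by
  rw [zero_shift_eq, scaleTo_update k 1 μ, one_mul]
  funext ν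
  rw [shiftN_apply, Site.add_apply]
  by_cases hν : ν = μ
  · subst hν
    rw [Function.update_self, if_pos rfl]
  · rw [Function.update_of_ne hν, if_neg hν, Site.zero_apply]

/-- `τ_{L^k e_μ} U₀ = (b ↦ U₀⟨shiftN b₋ μ L^k, b.dir⟩)` (lit ✓`TorusLimitAxioms.GaugeField.translate` vs ✓p840269's straight-shift field). [folklore] -/
theorem translate_scaleTo_eq_shiftN {G : Type*} (U₀ : GaugeField P 0 G) (k : ℕ) (μ : Fin P.d) :
    U₀.translate (Site.scaleTo k ((0 : Site P k).shift μ)) = fun b' : PBond P 0 => U₀ ⟨shiftN b'.src μ (P.L ^ k), b'.dir⟩ :=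
  translate_eq_shiftN U₀ _ μ _ (add_scaleTo_zero_shift k μ)

/-- ★ **THE RE-GAUGED TRANSLATE IS BONDWISE CURVATURE-CLOSE TO `U₀`**: with `h x := U₀[x, x + L^k e_μ]` and `U′ := h • τ_{L^k e_μ} U₀`, the plaquette class `dist1 U₀(∂p) ≤ α` gives
`dist1 (U′ b · U₀ b⁻¹) ≤ L^k·α` for EVERY bond (thin rectangle `R_{L^k × 1}`, ✓p840269). [cite: Balaban1985Averaging, (9), (19) pp.19-21; Balaban1985RegularSpaces, Lemma 1 p.79] -/
theorem dist1_regaugedTranslate_mul_inv_le {G : Type*} [GaugeGroup G] (U₀ : GaugeField P 0 G) (k : ℕ) (μ : Fin P.d) {α : ℝ} (hα0 : 0 ≤ α)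
    (hα : ∀ q : Plaq P 0, dist1 (GaugeField.plaqHol U₀ q) ≤ α) (b : PBond P 0) :
    dist1 (GaugeField.gaugeAct (fun x : Site P 0 => rowProd U₀ x μ (P.L ^ k)) (U₀.translate (Site.scaleTo k ((0 : Site P k).shift μ))) b * (U₀ b)⁻¹) ≤
      ((P.L ^ k : ℕ) : ℝ) * α := by
  rw [translate_scaleTo_eq_shiftN]
  exact dist1_gaugeAct_rowProd_shift_mul_inv_le U₀ hα0 hα μ (P.L ^ k) b

/-! ## §1 The exact identity: the re-gauged covariant translate reads `D^{U₀} X` one coarse step away, conjugated by the straight transport -/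

/-- ★★ **EQUIVARIANCE ∘ COVARIANCE** (any level-0 gauge transformation `h`, any coarse vector `v`, `a := L^k v`): under the (0.4) guard below `k` for `U₀`,
`↑(D^{h•τ_a U₀}(Ad_h (X∘τ_a)) c) = ↑(h_k c₋)·↑(D^{U₀} X (c + v))·↑(h_k c₋)⋆`. [cite: Balaban1985Averaging, (11)-(13) p.19, Prop. 4 (127) p.37; Balaban1987RG1, (0.11) p.253, (2.17) p.269] -/
theorem coe_fderiv_chartRead_iter_gaugeAct_translate (h : GaugeTransf P 0 (SU N)) (U₀ : GaugeField P 0 (SU N)) {k : ℕ} (hk : k ≤ P.m + P.K)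
    (hsb : SmallBelow (fun i => blockAvg (P := P) (j := i) (expMeanLogSU (n := Fin N))) k U₀) (v : Site P k)
    (X : PBond P 0 → (specialUnitaryLogChart (Fin N)).lie) (c : PBond P k) :
    ((fderiv ℝ (fun (A : PBond P 0 → (specialUnitaryLogChart (Fin N)).lie) (c : PBond P k) =>
          (isChartRep_specialUnitaryGroup (n := Fin N)).logChart
            (Averaging.iter (fun i => blockAvg (P := P) (j := i) (expMeanLogSU (n := Fin N))) k
                (fun b => (isChartRep_specialUnitaryGroup (n := Fin N)).expChart (A b) *
                  (GaugeField.gaugeAct h (U₀.translate (Site.scaleTo k v))) b) c *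
              (Averaging.iter (fun i => blockAvg (P := P) (j := i) (expMeanLogSU (n := Fin N))) k (GaugeField.gaugeAct h (U₀.translate (Site.scaleTo k v))) c)⁻¹)) 0
        (fun b : PBond P 0 => (⟨((h b.src : SU N) : Matrix (Fin N) (Fin N) ℂ) * ((X (b.translate (Site.scaleTo k v)) : (specialUnitaryLogChart (Fin N)).lie) : Matrix (Fin N) (Fin N) ℂ) *
            star ((h b.src : SU N) : Matrix (Fin N) (Fin N) ℂ), conj_mem_lie (h b.src) (X (b.translate (Site.scaleTo k v)))⟩ : (specialUnitaryLogChart (Fin N)).lie)) c :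
          (specialUnitaryLogChart (Fin N)).lie) : Matrix (Fin N) (Fin N) ℂ) =
      ((transfUp h k c.src : SU N) : Matrix (Fin N) (Fin N) ℂ) *
        ((fderiv ℝ (fun (A : PBond P 0 → (specialUnitaryLogChart (Fin N)).lie) (c : PBond P k) =>
            (isChartRep_specialUnitaryGroup (n := Fin N)).logChart
              (Averaging.iter (fun i => blockAvg (P := P) (j := i) (expMeanLogSU (n := Fin N))) k
                  (fun b => (isChartRep_specialUnitaryGroup (n := Fin N)).expChart (A b) * U₀ b) c *
                (Averaging.iter (fun i => blockAvg (P := P) (j := i) (expMeanLogSU (n := Fin N))) k U₀ c)⁻¹)) 0 X (c.translate v) :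
          (specialUnitaryLogChart (Fin N)).lie) : Matrix (Fin N) (Fin N) ℂ) *
        star ((transfUp h k c.src : SU N) : Matrix (Fin N) (Fin N) ℂ) := by
  have hsb1 := smallBelow_translate (N := N) U₀ k v hsb
  rw [coe_fderiv_chartRead_iter_gaugeAct h (U₀.translate (Site.scaleTo k v)) hk hsb1 (fun ℓ => X (ℓ.translate (Site.scaleTo k v))) c,
    fderiv_chartRead_iter_translate (N := N) U₀ k hsb v X c]

/-- ★★ **THE RE-GAUGED COVARIANT TRANSLATE READS `D^{U₀} X` ONE COARSE μ-STEP AWAY**: with `h x := U₀[x, x + L^k e_μ]`, `U′ := h • τ_{L^k e_μ} U₀`, `Y′ b := Ad_{h(b₋)} X(b + L^k e_μ)`: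
`↑(D^{U′} Y′ ⟨ȳ, κ⟩) = ↑(h_k ȳ)·↑(D^{U₀} X ⟨ȳ.shift μ, κ⟩)·↑(h_k ȳ)⋆`. [cite: Balaban1985Averaging, Prop. 4 (127)-(128) p.37; Balaban1987RG1, (0.11) p.253] -/
theorem coe_fderiv_regaugedTranslate (U₀ : GaugeField P 0 (SU N)) (μ : Fin P.d) {k : ℕ} (hk : k ≤ P.m + P.K)
    (hsb : SmallBelow (fun i => blockAvg (P := P) (j := i) (expMeanLogSU (n := Fin N))) k U₀)
    (X : PBond P 0 → (specialUnitaryLogChart (Fin N)).lie) (y : Site P k) (κ : Fin P.d) :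
    ((fderiv ℝ (fun (A : PBond P 0 → (specialUnitaryLogChart (Fin N)).lie) (c : PBond P k) =>
          (isChartRep_specialUnitaryGroup (n := Fin N)).logChart
            (Averaging.iter (fun i => blockAvg (P := P) (j := i) (expMeanLogSU (n := Fin N))) k
                (fun b => (isChartRep_specialUnitaryGroup (n := Fin N)).expChart (A b) *
                  (GaugeField.gaugeAct (fun x : Site P 0 => rowProd U₀ x μ (P.L ^ k)) (U₀.translate (Site.scaleTo k ((0 : Site P k).shift μ)))) b) c *
              (Averaging.iter (fun i => blockAvg (P := P) (j := i) (expMeanLogSU (n := Fin N))) k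
                (GaugeField.gaugeAct (fun x : Site P 0 => rowProd U₀ x μ (P.L ^ k)) (U₀.translate (Site.scaleTo k ((0 : Site P k).shift μ)))) c)⁻¹)) 0
        (fun b : PBond P 0 => (⟨((rowProd U₀ b.src μ (P.L ^ k) : SU N) : Matrix (Fin N) (Fin N) ℂ) *
            ((X (b.translate (Site.scaleTo k ((0 : Site P k).shift μ))) : (specialUnitaryLogChart (Fin N)).lie) : Matrix (Fin N) (Fin N) ℂ) *
            star ((rowProd U₀ b.src μ (P.L ^ k) : SU N) : Matrix (Fin N) (Fin N) ℂ),
            conj_mem_lie (rowProd U₀ b.src μ (P.L ^ k)) (X (b.translate (Site.scaleTo k ((0 : Site P k).shift μ))))⟩ : (specialUnitaryLogChart (Fin N)).lie)) ⟨y, κ⟩ :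
          (specialUnitaryLogChart (Fin N)).lie) : Matrix (Fin N) (Fin N) ℂ) =
      ((transfUp (fun x : Site P 0 => rowProd U₀ x μ (P.L ^ k)) k y : SU N) : Matrix (Fin N) (Fin N) ℂ) *
        ((fderiv ℝ (fun (A : PBond P 0 → (specialUnitaryLogChart (Fin N)).lie) (c : PBond P k) =>
            (isChartRep_specialUnitaryGroup (n := Fin N)).logChart
              (Averaging.iter (fun i => blockAvg (P := P) (j := i) (expMeanLogSU (n := Fin N))) k
                  (fun b => (isChartRep_specialUnitaryGroup (n := Fin N)).expChart (A b) * U₀ b) c *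
                (Averaging.iter (fun i => blockAvg (P := P) (j := i) (expMeanLogSU (n := Fin N))) k U₀ c)⁻¹)) 0 X ⟨y.shift μ, κ⟩ :
          (specialUnitaryLogChart (Fin N)).lie) : Matrix (Fin N) (Fin N) ℂ) *
        star ((transfUp (fun x : Site P 0 => rowProd U₀ x μ (P.L ^ k)) k y : SU N) : Matrix (Fin N) (Fin N) ℂ) := by
  rw [coe_fderiv_chartRead_iter_gaugeAct_translate (fun x : Site P 0 => rowProd U₀ x μ (P.L ^ k)) U₀ hk hsb ((0 : Site P k).shift μ) X ⟨y, κ⟩,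
    translate_zero_shift]

/-! ## §2 hDcov from the letters -/

/-- `‖G·M·G⋆ − u·M·u⋆‖ ≤ 2·‖G − u‖·‖M‖` for `G, u ∈ SU(N)` (`G M G⋆ − u M u⋆ = (G − u) M G⋆ + u M (G − u)⋆`, unitaries have operator norm `≤ 1`). [folklore] -/
theorem norm_conj_sub_conj_le (G u : SU N) (M : Matrix (Fin N) (Fin N) ℂ) :
    ‖(G : Matrix (Fin N) (Fin N) ℂ) * M * star (G : Matrix (Fin N) (Fin N) ℂ) - (u : Matrix (Fin N) (Fin N) ℂ) * M * star (u : Matrix (Fin N) (Fin N) ℂ)‖ ≤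
      2 * ‖(G : Matrix (Fin N) (Fin N) ℂ) - (u : Matrix (Fin N) (Fin N) ℂ)‖ * ‖M‖ := by
  have hG : ‖star (G : Matrix (Fin N) (Fin N) ℂ)‖ ≤ 1 := by rw [norm_star]; exact norm_coe_SU_le_one G
  have hu : ‖(u : Matrix (Fin N) (Fin N) ℂ)‖ ≤ 1 := norm_coe_SU_le_one u
  have hsplit : (G : Matrix (Fin N) (Fin N) ℂ) * M * star (G : Matrix (Fin N) (Fin N) ℂ) - (u : Matrix (Fin N) (Fin N) ℂ) * M * star (u : Matrix (Fin N) (Fin N) ℂ) =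
      ((G : Matrix (Fin N) (Fin N) ℂ) - (u : Matrix (Fin N) (Fin N) ℂ)) * M * star (G : Matrix (Fin N) (Fin N) ℂ) +
        (u : Matrix (Fin N) (Fin N) ℂ) * M * star ((G : Matrix (Fin N) (Fin N) ℂ) - (u : Matrix (Fin N) (Fin N) ℂ)) := by
    rw [star_sub]; noncomm_ring
  rw [hsplit]
  refine (norm_add_le _ _).trans ?_
  have h1 : ‖((G : Matrix (Fin N) (Fin N) ℂ) - (u : Matrix (Fin N) (Fin N) ℂ)) * M * star (G : Matrix (Fin N) (Fin N) ℂ)‖ ≤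
      ‖(G : Matrix (Fin N) (Fin N) ℂ) - (u : Matrix (Fin N) (Fin N) ℂ)‖ * ‖M‖ := by
    refine (norm_mul_le _ _).trans ?_
    calc _ ≤ ‖((G : Matrix (Fin N) (Fin N) ℂ) - (u : Matrix (Fin N) (Fin N) ℂ)) * M‖ * 1 := by gcongr
      _ ≤ ‖(G : Matrix (Fin N) (Fin N) ℂ) - (u : Matrix (Fin N) (Fin N) ℂ)‖ * ‖M‖ := by rw [mul_one]; exact norm_mul_le _ _
  have h2 : ‖(u : Matrix (Fin N) (Fin N) ℂ) * M * star ((G : Matrix (Fin N) (Fin N) ℂ) - (u : Matrix (Fin N) (Fin N) ℂ))‖ ≤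
      ‖(G : Matrix (Fin N) (Fin N) ℂ) - (u : Matrix (Fin N) (Fin N) ℂ)‖ * ‖M‖ := by
    refine (norm_mul_le _ _).trans ?_
    rw [norm_star]
    have h3 : ‖(u : Matrix (Fin N) (Fin N) ℂ) * M‖ ≤ ‖M‖ := by
      calc _ ≤ ‖(u : Matrix (Fin N) (Fin N) ℂ)‖ * ‖M‖ := norm_mul_le _ _
        _ ≤ 1 * ‖M‖ := by gcongr
        _ = ‖M‖ := one_mul _
    calc _ ≤ ‖M‖ * ‖(G : Matrix (Fin N) (Fin N) ℂ) - (u : Matrix (Fin N) (Fin N) ℂ)‖ := by gcongr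
      _ = _ := mul_comm _ _
  linarith

/-- ★★★ **hDcov FROM THE LETTERS** (the second conjunct of px13 g29's ✓p840162 `hDcov` at the coarse bond `⟨ȳ, μ⟩`, with `β := 2·ε·Λ + β₁`): under the (0.4) guard below `k` for `U₀`,
a sup bound `Λ` on `↑(D^{U₀} X)`, the LINE-VS-AVERAGE letter `‖↑(Ū^k U₀ ⟨ȳ,μ⟩) − ↑(h_k ȳ)‖ ≤ ε` (straight fine transport vs the averaged coarse bond) and the BACKGROUND-LIPSCHITZ
letter `‖↑(D^{U′} Y′ c) − ↑(D^{U₀} Y′ c)‖ ≤ β₁` (U′ = the re-gauged translate, bondwise `L^k·α`-close to `U₀` by `dist1_regaugedTranslate_mul_inv_le`):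
**`‖↑Ū⟨ȳ,μ⟩·↑(D^{U₀} X ⟨ȳ.shift μ, κ⟩)·↑Ū⟨ȳ,μ⟩⋆ − ↑(D^{U₀} Y′ ⟨ȳ, κ⟩)‖ ≤ 2·ε·Λ + β₁`**. [cite: Balaban1985Averaging, Prop. 4 (128)-(131) pp.37-38, (124)-(125) p.36; Balaban1987RG1, (0.11) p.253] -/
theorem hDcov_of_letters (U₀ : GaugeField P 0 (SU N)) (μ : Fin P.d) {k : ℕ} (hk : k ≤ P.m + P.K)
    (hsb : SmallBelow (fun i => blockAvg (P := P) (j := i) (expMeanLogSU (n := Fin N))) k U₀)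
    (X : PBond P 0 → (specialUnitaryLogChart (Fin N)).lie) {Λ ε β₁ : ℝ}
    (hD : ∀ c : PBond P k, ‖((fderiv ℝ (fun (A : PBond P 0 → (specialUnitaryLogChart (Fin N)).lie) (c : PBond P k) =>
            (isChartRep_specialUnitaryGroup (n := Fin N)).logChart
              (Averaging.iter (fun i => blockAvg (P := P) (j := i) (expMeanLogSU (n := Fin N))) k
                  (fun b => (isChartRep_specialUnitaryGroup (n := Fin N)).expChart (A b) * U₀ b) c *
                (Averaging.iter (fun i => blockAvg (P := P) (j := i) (expMeanLogSU (n := Fin N))) k U₀ c)⁻¹)) 0 X c :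
          (specialUnitaryLogChart (Fin N)).lie) : Matrix (Fin N) (Fin N) ℂ)‖ ≤ Λ)
    (hline : ∀ y : Site P k, ‖((Averaging.iter (fun i => blockAvg (P := P) (j := i) (expMeanLogSU (n := Fin N))) k U₀ ⟨y, μ⟩ : SU N) : Matrix (Fin N) (Fin N) ℂ) -
        ((transfUp (fun x : Site P 0 => rowProd U₀ x μ (P.L ^ k)) k y : SU N) : Matrix (Fin N) (Fin N) ℂ)‖ ≤ ε)
    (hLip : ∀ c : PBond P k, ‖((fderiv ℝ (fun (A : PBond P 0 → (specialUnitaryLogChart (Fin N)).lie) (c : PBond P k) =>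
            (isChartRep_specialUnitaryGroup (n := Fin N)).logChart
              (Averaging.iter (fun i => blockAvg (P := P) (j := i) (expMeanLogSU (n := Fin N))) k
                  (fun b => (isChartRep_specialUnitaryGroup (n := Fin N)).expChart (A b) *
                    (GaugeField.gaugeAct (fun x : Site P 0 => rowProd U₀ x μ (P.L ^ k)) (U₀.translate (Site.scaleTo k ((0 : Site P k).shift μ)))) b) c *
                (Averaging.iter (fun i => blockAvg (P := P) (j := i) (expMeanLogSU (n := Fin N))) k
                  (GaugeField.gaugeAct (fun x : Site P 0 => rowProd U₀ x μ (P.L ^ k)) (U₀.translate (Site.scaleTo k ((0 : Site P k).shift μ)))) c)⁻¹)) 0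
          (fun b : PBond P 0 => (⟨((rowProd U₀ b.src μ (P.L ^ k) : SU N) : Matrix (Fin N) (Fin N) ℂ) *
              ((X (b.translate (Site.scaleTo k ((0 : Site P k).shift μ))) : (specialUnitaryLogChart (Fin N)).lie) : Matrix (Fin N) (Fin N) ℂ) *
              star ((rowProd U₀ b.src μ (P.L ^ k) : SU N) : Matrix (Fin N) (Fin N) ℂ),
              conj_mem_lie (rowProd U₀ b.src μ (P.L ^ k)) (X (b.translate (Site.scaleTo k ((0 : Site P k).shift μ))))⟩ : (specialUnitaryLogChart (Fin N)).lie)) c :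
            (specialUnitaryLogChart (Fin N)).lie) : Matrix (Fin N) (Fin N) ℂ) -
        ((fderiv ℝ (fun (A : PBond P 0 → (specialUnitaryLogChart (Fin N)).lie) (c : PBond P k) =>
            (isChartRep_specialUnitaryGroup (n := Fin N)).logChart
              (Averaging.iter (fun i => blockAvg (P := P) (j := i) (expMeanLogSU (n := Fin N))) k
                  (fun b => (isChartRep_specialUnitaryGroup (n := Fin N)).expChart (A b) * U₀ b) c *
                (Averaging.iter (fun i => blockAvg (P := P) (j := i) (expMeanLogSU (n := Fin N))) k U₀ c)⁻¹)) 0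
          (fun b : PBond P 0 => (⟨((rowProd U₀ b.src μ (P.L ^ k) : SU N) : Matrix (Fin N) (Fin N) ℂ) *
              ((X (b.translate (Site.scaleTo k ((0 : Site P k).shift μ))) : (specialUnitaryLogChart (Fin N)).lie) : Matrix (Fin N) (Fin N) ℂ) *
              star ((rowProd U₀ b.src μ (P.L ^ k) : SU N) : Matrix (Fin N) (Fin N) ℂ),
              conj_mem_lie (rowProd U₀ b.src μ (P.L ^ k)) (X (b.translate (Site.scaleTo k ((0 : Site P k).shift μ))))⟩ : (specialUnitaryLogChart (Fin N)).lie)) c :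
            (specialUnitaryLogChart (Fin N)).lie) : Matrix (Fin N) (Fin N) ℂ)‖ ≤ β₁)
    (y : Site P k) (κ : Fin P.d) :
    ‖((Averaging.iter (fun i => blockAvg (P := P) (j := i) (expMeanLogSU (n := Fin N))) k U₀ ⟨y, μ⟩ : SU N) : Matrix (Fin N) (Fin N) ℂ) *
          ((fderiv ℝ (fun (A : PBond P 0 → (specialUnitaryLogChart (Fin N)).lie) (c : PBond P k) =>
              (isChartRep_specialUnitaryGroup (n := Fin N)).logChart
                (Averaging.iter (fun i => blockAvg (P := P) (j := i) (expMeanLogSU (n := Fin N))) k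
                    (fun b => (isChartRep_specialUnitaryGroup (n := Fin N)).expChart (A b) * U₀ b) c *
                  (Averaging.iter (fun i => blockAvg (P := P) (j := i) (expMeanLogSU (n := Fin N))) k U₀ c)⁻¹)) 0 X ⟨y.shift μ, κ⟩ :
            (specialUnitaryLogChart (Fin N)).lie) : Matrix (Fin N) (Fin N) ℂ) *
          star ((Averaging.iter (fun i => blockAvg (P := P) (j := i) (expMeanLogSU (n := Fin N))) k U₀ ⟨y, μ⟩ : SU N) : Matrix (Fin N) (Fin N) ℂ) -
        ((fderiv ℝ (fun (A : PBond P 0 → (specialUnitaryLogChart (Fin N)).lie) (c : PBond P k) =>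
            (isChartRep_specialUnitaryGroup (n := Fin N)).logChart
              (Averaging.iter (fun i => blockAvg (P := P) (j := i) (expMeanLogSU (n := Fin N))) k
                  (fun b => (isChartRep_specialUnitaryGroup (n := Fin N)).expChart (A b) * U₀ b) c *
                (Averaging.iter (fun i => blockAvg (P := P) (j := i) (expMeanLogSU (n := Fin N))) k U₀ c)⁻¹)) 0
          (fun b : PBond P 0 => (⟨((rowProd U₀ b.src μ (P.L ^ k) : SU N) : Matrix (Fin N) (Fin N) ℂ) *
              ((X (b.translate (Site.scaleTo k ((0 : Site P k).shift μ))) : (specialUnitaryLogChart (Fin N)).lie) : Matrix (Fin N) (Fin N) ℂ) *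
              star ((rowProd U₀ b.src μ (P.L ^ k) : SU N) : Matrix (Fin N) (Fin N) ℂ),
              conj_mem_lie (rowProd U₀ b.src μ (P.L ^ k)) (X (b.translate (Site.scaleTo k ((0 : Site P k).shift μ))))⟩ : (specialUnitaryLogChart (Fin N)).lie)) ⟨y, κ⟩ :
            (specialUnitaryLogChart (Fin N)).lie) : Matrix (Fin N) (Fin N) ℂ)‖ ≤ 2 * ε * Λ + β₁ := by
  have hE := coe_fderiv_regaugedTranslate U₀ μ hk hsb X y κ
  -- abbreviate the four matrices
  set G : Matrix (Fin N) (Fin N) ℂ := ((Averaging.iter (fun i => blockAvg (P := P) (j := i) (expMeanLogSU (n := Fin N))) k U₀ ⟨y, μ⟩ : SU N) : Matrix (Fin N) (Fin N) ℂ) with hGdef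
  set u : Matrix (Fin N) (Fin N) ℂ := ((transfUp (fun x : Site P 0 => rowProd U₀ x μ (P.L ^ k)) k y : SU N) : Matrix (Fin N) (Fin N) ℂ) with hudef
  set M : Matrix (Fin N) (Fin N) ℂ := ((fderiv ℝ (fun (A : PBond P 0 → (specialUnitaryLogChart (Fin N)).lie) (c : PBond P k) =>
              (isChartRep_specialUnitaryGroup (n := Fin N)).logChart
                (Averaging.iter (fun i => blockAvg (P := P) (j := i) (expMeanLogSU (n := Fin N))) k
                    (fun b => (isChartRep_specialUnitaryGroup (n := Fin N)).expChart (A b) * U₀ b) c *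
                  (Averaging.iter (fun i => blockAvg (P := P) (j := i) (expMeanLogSU (n := Fin N))) k U₀ c)⁻¹)) 0 X ⟨y.shift μ, κ⟩ :
            (specialUnitaryLogChart (Fin N)).lie) : Matrix (Fin N) (Fin N) ℂ) with hMdef
  -- the Lipschitz letter at `⟨ȳ, κ⟩`, its first term rewritten by the exact identity `D^{U′} Y′ ⟨ȳ,κ⟩ = u M u⋆`
  have hDUY := hLip ⟨y, κ⟩
  rw [hE] at hDUY
  have h1 := norm_conj_sub_conj_le (Averaging.iter (fun i => blockAvg (P := P) (j := i) (expMeanLogSU (n := Fin N))) k U₀ ⟨y, μ⟩)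
    (transfUp (fun x : Site P 0 => rowProd U₀ x μ (P.L ^ k)) k y) M
  rw [← hGdef, ← hudef] at h1
  have hGu : ‖G - u‖ ≤ ε := hline y
  have hM : ‖M‖ ≤ Λ := hD ⟨y.shift μ, κ⟩
  have hε0 : 0 ≤ ε := (norm_nonneg _).trans hGu
  have h2 : 2 * ‖G - u‖ * ‖M‖ ≤ 2 * ε * Λ := by
    have := mul_le_mul hGu hM (norm_nonneg _) hε0
    nlinarith [this, norm_nonneg (G - u), norm_nonneg M]
  have key : ∀ DY' : Matrix (Fin N) (Fin N) ℂ, ‖u * M * star u - DY'‖ ≤ β₁ → ‖G * M * star G - DY'‖ ≤ 2 * ε * Λ + β₁ := by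
    intro DY' hDY'
    calc ‖G * M * star G - DY'‖ = ‖(G * M * star G - u * M * star u) + (u * M * star u - DY')‖ := by congr 1; abel
      _ ≤ ‖G * M * star G - u * M * star u‖ + ‖u * M * star u - DY'‖ := norm_add_le _ _
      _ ≤ 2 * ‖G - u‖ * ‖M‖ + β₁ := add_le_add h1 hDY'
      _ ≤ 2 * ε * Λ + β₁ := by linarith
  exact key _ hDUY

/-- ★★ **hDcov IN px13 g29's BINDER SHAPE** (`∀ ȳ, ∃ Y′, (∀ b, ‖↑(Y′ b) − ↑(X b)‖ ≤ ℓ·c₀) ∧ ∀ κ, ‖Ū·D X·Ū⋆ − D Y′‖ ≤ β`, Lie-valued data, `β := 2εΛ + β₁`): the witness is the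
COVARIANT TRANSLATE `Y′ b := Ad_{U₀[b₋, b₋ + L^k e_μ]} X(b + L^k e_μ)`, and its first conjunct is exactly the covariant μ-word oscillation of `X` over `L^k` fine steps
(hypothesis `hc₀` — px13's `c₀` letter, e.g. by ✓p839768 `wordOsc_of_step`). [cite: Balaban1985Averaging, Prop. 4 (128)-(131) pp.37-38, (124)-(125) p.36] -/
theorem hDcov_of_letters_exists (U₀ : GaugeField P 0 (SU N)) (μ : Fin P.d) {k : ℕ} (hk : k ≤ P.m + P.K)
    (hsb : SmallBelow (fun i => blockAvg (P := P) (j := i) (expMeanLogSU (n := Fin N))) k U₀)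
    (X : PBond P 0 → (specialUnitaryLogChart (Fin N)).lie) {Λ ε β₁ ℓ c₀ : ℝ}
    (hc₀ : ∀ b : PBond P 0, ‖((rowProd U₀ b.src μ (P.L ^ k) : SU N) : Matrix (Fin N) (Fin N) ℂ) *
          ((X (b.translate (Site.scaleTo k ((0 : Site P k).shift μ))) : (specialUnitaryLogChart (Fin N)).lie) : Matrix (Fin N) (Fin N) ℂ) *
          star ((rowProd U₀ b.src μ (P.L ^ k) : SU N) : Matrix (Fin N) (Fin N) ℂ) - ((X b : (specialUnitaryLogChart (Fin N)).lie) : Matrix (Fin N) (Fin N) ℂ)‖ ≤ ℓ * c₀)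
    (hD : ∀ c : PBond P k, ‖((fderiv ℝ (fun (A : PBond P 0 → (specialUnitaryLogChart (Fin N)).lie) (c : PBond P k) =>
            (isChartRep_specialUnitaryGroup (n := Fin N)).logChart
              (Averaging.iter (fun i => blockAvg (P := P) (j := i) (expMeanLogSU (n := Fin N))) k
                  (fun b => (isChartRep_specialUnitaryGroup (n := Fin N)).expChart (A b) * U₀ b) c *
                (Averaging.iter (fun i => blockAvg (P := P) (j := i) (expMeanLogSU (n := Fin N))) k U₀ c)⁻¹)) 0 X c : (specialUnitaryLogChart (Fin N)).lie) : Matrix (Fin N) (Fin N) ℂ)‖ ≤ Λ)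
    (hline : ∀ y : Site P k, ‖((Averaging.iter (fun i => blockAvg (P := P) (j := i) (expMeanLogSU (n := Fin N))) k U₀ ⟨y, μ⟩ : SU N) : Matrix (Fin N) (Fin N) ℂ) -
        ((transfUp (fun x : Site P 0 => rowProd U₀ x μ (P.L ^ k)) k y : SU N) : Matrix (Fin N) (Fin N) ℂ)‖ ≤ ε)
    (hLip : ∀ c : PBond P k, ‖((fderiv ℝ (fun (A : PBond P 0 → (specialUnitaryLogChart (Fin N)).lie) (c : PBond P k) =>
            (isChartRep_specialUnitaryGroup (n := Fin N)).logChart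
              (Averaging.iter (fun i => blockAvg (P := P) (j := i) (expMeanLogSU (n := Fin N))) k
                  (fun b => (isChartRep_specialUnitaryGroup (n := Fin N)).expChart (A b) *
                    (GaugeField.gaugeAct (fun x : Site P 0 => rowProd U₀ x μ (P.L ^ k)) (U₀.translate (Site.scaleTo k ((0 : Site P k).shift μ)))) b) c *
                (Averaging.iter (fun i => blockAvg (P := P) (j := i) (expMeanLogSU (n := Fin N))) k
                  (GaugeField.gaugeAct (fun x : Site P 0 => rowProd U₀ x μ (P.L ^ k)) (U₀.translate (Site.scaleTo k ((0 : Site P k).shift μ)))) c)⁻¹)) 0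
          (fun b : PBond P 0 => (⟨((rowProd U₀ b.src μ (P.L ^ k) : SU N) : Matrix (Fin N) (Fin N) ℂ) *
              ((X (b.translate (Site.scaleTo k ((0 : Site P k).shift μ))) : (specialUnitaryLogChart (Fin N)).lie) : Matrix (Fin N) (Fin N) ℂ) *
              star ((rowProd U₀ b.src μ (P.L ^ k) : SU N) : Matrix (Fin N) (Fin N) ℂ),
              conj_mem_lie (rowProd U₀ b.src μ (P.L ^ k)) (X (b.translate (Site.scaleTo k ((0 : Site P k).shift μ))))⟩ : (specialUnitaryLogChart (Fin N)).lie)) c :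
            (specialUnitaryLogChart (Fin N)).lie) : Matrix (Fin N) (Fin N) ℂ) -
        ((fderiv ℝ (fun (A : PBond P 0 → (specialUnitaryLogChart (Fin N)).lie) (c : PBond P k) =>
            (isChartRep_specialUnitaryGroup (n := Fin N)).logChart
              (Averaging.iter (fun i => blockAvg (P := P) (j := i) (expMeanLogSU (n := Fin N))) k
                  (fun b => (isChartRep_specialUnitaryGroup (n := Fin N)).expChart (A b) * U₀ b) c *
                (Averaging.iter (fun i => blockAvg (P := P) (j := i) (expMeanLogSU (n := Fin N))) k U₀ c)⁻¹)) 0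
          (fun b : PBond P 0 => (⟨((rowProd U₀ b.src μ (P.L ^ k) : SU N) : Matrix (Fin N) (Fin N) ℂ) *
              ((X (b.translate (Site.scaleTo k ((0 : Site P k).shift μ))) : (specialUnitaryLogChart (Fin N)).lie) : Matrix (Fin N) (Fin N) ℂ) *
              star ((rowProd U₀ b.src μ (P.L ^ k) : SU N) : Matrix (Fin N) (Fin N) ℂ),
              conj_mem_lie (rowProd U₀ b.src μ (P.L ^ k)) (X (b.translate (Site.scaleTo k ((0 : Site P k).shift μ))))⟩ : (specialUnitaryLogChart (Fin N)).lie)) c :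
            (specialUnitaryLogChart (Fin N)).lie) : Matrix (Fin N) (Fin N) ℂ)‖ ≤ β₁)
    (y : Site P k) :
    ∃ Y' : PBond P 0 → (specialUnitaryLogChart (Fin N)).lie, (∀ b : PBond P 0, ‖((Y' b : (specialUnitaryLogChart (Fin N)).lie) : Matrix (Fin N) (Fin N) ℂ) - ((X b : (specialUnitaryLogChart (Fin N)).lie) : Matrix (Fin N) (Fin N) ℂ)‖ ≤ ℓ * c₀) ∧
      ∀ κ : Fin P.d, ‖((Averaging.iter (fun i => blockAvg (P := P) (j := i) (expMeanLogSU (n := Fin N))) k U₀ ⟨y, μ⟩ : SU N) : Matrix (Fin N) (Fin N) ℂ) *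
          ((fderiv ℝ (fun (A : PBond P 0 → (specialUnitaryLogChart (Fin N)).lie) (c : PBond P k) =>
            (isChartRep_specialUnitaryGroup (n := Fin N)).logChart
              (Averaging.iter (fun i => blockAvg (P := P) (j := i) (expMeanLogSU (n := Fin N))) k
                  (fun b => (isChartRep_specialUnitaryGroup (n := Fin N)).expChart (A b) * U₀ b) c *
                (Averaging.iter (fun i => blockAvg (P := P) (j := i) (expMeanLogSU (n := Fin N))) k U₀ c)⁻¹)) 0 X ⟨y.shift μ, κ⟩ :
            (specialUnitaryLogChart (Fin N)).lie) : Matrix (Fin N) (Fin N) ℂ) *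
          star ((Averaging.iter (fun i => blockAvg (P := P) (j := i) (expMeanLogSU (n := Fin N))) k U₀ ⟨y, μ⟩ : SU N) : Matrix (Fin N) (Fin N) ℂ) -
        ((fderiv ℝ (fun (A : PBond P 0 → (specialUnitaryLogChart (Fin N)).lie) (c : PBond P k) =>
            (isChartRep_specialUnitaryGroup (n := Fin N)).logChart
              (Averaging.iter (fun i => blockAvg (P := P) (j := i) (expMeanLogSU (n := Fin N))) k
                  (fun b => (isChartRep_specialUnitaryGroup (n := Fin N)).expChart (A b) * U₀ b) c *
                (Averaging.iter (fun i => blockAvg (P := P) (j := i) (expMeanLogSU (n := Fin N))) k U₀ c)⁻¹)) 0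
          (fun b : PBond P 0 => (⟨((rowProd U₀ b.src μ (P.L ^ k) : SU N) : Matrix (Fin N) (Fin N) ℂ) *
              ((X (b.translate (Site.scaleTo k ((0 : Site P k).shift μ))) : (specialUnitaryLogChart (Fin N)).lie) : Matrix (Fin N) (Fin N) ℂ) *
              star ((rowProd U₀ b.src μ (P.L ^ k) : SU N) : Matrix (Fin N) (Fin N) ℂ),
              conj_mem_lie (rowProd U₀ b.src μ (P.L ^ k)) (X (b.translate (Site.scaleTo k ((0 : Site P k).shift μ))))⟩ : (specialUnitaryLogChart (Fin N)).lie)) ⟨y, κ⟩ :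
            (specialUnitaryLogChart (Fin N)).lie) : Matrix (Fin N) (Fin N) ℂ)‖ ≤ 2 * ε * Λ + β₁ :=
  ⟨(fun b : PBond P 0 => (⟨((rowProd U₀ b.src μ (P.L ^ k) : SU N) : Matrix (Fin N) (Fin N) ℂ) *
              ((X (b.translate (Site.scaleTo k ((0 : Site P k).shift μ))) : (specialUnitaryLogChart (Fin N)).lie) : Matrix (Fin N) (Fin N) ℂ) *
              star ((rowProd U₀ b.src μ (P.L ^ k) : SU N) : Matrix (Fin N) (Fin N) ℂ),
              conj_mem_lie (rowProd U₀ b.src μ (P.L ^ k)) (X (b.translate (Site.scaleTo k ((0 : Site P k).shift μ))))⟩ : (specialUnitaryLogChart (Fin N)).lie)), hc₀, fun κ => hDcov_of_letters U₀ μ hk hsb X hD hline hLip y κ⟩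

end Summit.QuantumFields.YangMills.Theorems.FluctuationComparisonRegPrIntLS2BetaChartReadDerivCovariantTranslation

end
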